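import Literature.NumberTheory.Automorphic.ResGLnCuspidalCohomologyApexSubmodule
import Literature.NumberTheory.Automorphic.CuspFormsNoUnipotentArchInvariants
import Mathlib.LinearAlgebra.Eigenspace.Triangularizable
import Mathlib.Analysis.Complex.Polynomial.Basic
import HarnessLib

/-!
# Cuspidal `(𝔤, K_∞)`-modules of `GL_n`, `n ≥ 2`, have no finite-dimensional constituent:
# `H⁰ = 0`, and a non-zero `(𝔤, K_∞)`-cohomology class yields a non-zero basic cochain

Topic `NumberTheory/Automorphic`; namespaces `Literature.NumberTheory.Automorphic.Kuga` (linear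
algebra of skew operators), `….TensorContract` (the contraction `V ⊗ E → Hom(E^*, V)`, one small
definition with body) and `….ConeDictionary` (vocabulary of `ResGLnCuspidalCohomologyApexModule`).
Theorems and one auxiliary definition (`TensorContract.contract`); no named fact, no `sorry`.

This is the degree bookkeeping between the archimedean existence theorem for unitary
`(𝔤, K_∞)`-modules with the infinitesimal character of `E_λ^∨` — "`H^q(𝔤, K_∞; V ⊗ (E_λ ⊗ ε_S)) ≠ 0`
for some `q`, `S`" (Vogan–Zuckerman / Salamanca-Riba; Clozel's Lemme 3.14 for the generic `π_v`) —
and the entry point `ConeDictionary.Clozel1990_exists_basic_levelFixed_cocycle_of_nonzero_moduleCochain`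
(`ResGLnCuspidalCohomologyApexSubmodule`) of the Kuga reduction of the apex fact
`Clozel1990_exists_basic_levelFixed_cocycle`, which wants a NON-ZERO BASIC cochain (`i_Z z = 0`) of
POSITIVE degree of `C^•(𝔤, K_∞; V ⊗ (E_λ ⊗ ε_S))` for a `(𝔤, K_∞)`-module `V` embedded in the cusp
forms:

* `Kuga.eq_zero_of_skew_of_commutator_eq_smul` — on a finite-dimensional complex space with a
  positive definite Hermitian form, `H` skew and `H X - X H = r X`, `r ∈ ℝ ∖ 0`, force `X = 0`
  (imaginary spectrum of `H`; `X` shifts generalised eigenspaces by `r`);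
* `Kuga.lieHom_apply_eq_zero_of_trace_eq_zero` — a real Lie action of `𝔤𝔩_n(𝕜)` (`𝕜 = ℝ, ℂ`) on
  such a space with `E_ii - E_jj` skew kills `𝔰𝔩_n(𝕜)` ("finite-dimensional unitary representations
  of `𝔰𝔩_n` are trivial");
* `ConeDictionary.eq_bot_of_finiteDimensional_of_lie_stable` — for a clean cuspidal `π` of
  `GL_n(𝔸_K)`, `n ≥ 2`, a `𝔤`-module `V` with an injective intertwiner into `W` has no non-zero
  finite-dimensional `𝔤`-stable subspace (Petersson skew-adjointness `pet_lieDerivW_left` and the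
  vanishing of cusp forms killed by the square-zero directions at one place,
  `eq_zero_of_mem_cuspFormsGL_of_forall_lieDeriv_eq_zero`) [cite: Harder1987, §3.1];
* `ConeDictionary.eq_zero_of_lie_invariant` — hence `H⁰(𝔤; V ⊗ E_λ) = 0`: a `𝔤`-invariant of
  `V ⊗ E_λ(ℂ)` vanishes (its contractions span a finite-dimensional `𝔤`-stable subspace)
  [cite: BorelWallach2000, I 5.3];
* **`ConeDictionary.exists_nonzero_basic_of_nontrivial_cohomology`** — if `Z = 1` acts on `V` by a
  scalar and `H^q(𝔤, K_∞; V ⊗ (E_λ ⊗ ε_S)) ≠ 0`, there is a non-zero cochain `z ∈ C^{q'+1}` of the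
  `(𝔤, K_∞)`-complex with `i_Z z = 0` (Cartan's formula `θ_Z = d i_Z + i_Z d` in the corner `q = 1`)
  [cite: BorelWallach2000, I §1.3].

## References

* A. Borel, N. Wallach, *Continuous cohomology, discrete subgroups, and representations of reductive
  groups*, 2nd ed. (2000), I §1.3, I 5.3 (held). [BorelWallach2000]
* G. Harder, *Eisenstein cohomology of arithmetic groups. The case `GL₂`*, Invent. Math. 89 (1987),
  §3.1. [Harder1987]
* L. Clozel, *Motifs et formes automorphes* (1990), Lemme 3.14 (p. 114), §3.5. [Clozel1990]
-/

noncomputable section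

-- Mathlib idiom (Mathlib/Algebra/Lie/OfAssociative.lean), as in `GKModules`: commutator brackets on
-- matrix algebras and on `Module.End ℂ V`
attribute [local instance 100] LieRing.ofAssociativeRing

open scoped ComplexConjugate TensorProduct Classical _root_.Matrix
open _root_.NumberField _root_.NumberField.InfinitePlace _root_.NumberField.mixedEmbedding IsDedekindDomain

namespace Literature.NumberTheory.Automorphic

namespace Kuga

variable {U : Type*} [AddCommGroup U] [Module ℂ U]

/-- An eigenvalue of an operator which is skew for a positive definite Hermitian form is purely
imaginary: `conj μ = -μ`. [folklore] -/
theorem conj_eq_neg_of_hasEigenvalue_of_skew {ip : U → U → ℂ} (hip : IsPosForm ip) {H : Module.End ℂ U}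
    (hH : ∀ u v, ip (H u) v = -ip u (H v)) {μ : ℂ} (hμ : H.HasEigenvalue μ) : conj μ = -μ := by
  obtain ⟨u, hu, hu0⟩ := hμ.exists_hasEigenvector
  have h1 : ip (H u) u = conj μ * ip u u := by
    rw [Module.End.mem_eigenspace_iff.mp hu, hip.smul_left]
  have h2 : ip (H u) u = -(μ * ip u u) := by
    rw [hH, Module.End.mem_eigenspace_iff.mp hu, hip.smul_right]
  have hne : ip u u ≠ 0 := fun h0 => hu0 (hip.definite u h0)
  have h3 : (conj μ + μ) * ip u u = 0 := by rw [add_mul, ← h1, h2]; ring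
  rcases mul_eq_zero.mp h3 with h | h
  · exact eq_neg_of_add_eq_zero_left h
  · exact absurd h hne

/-- `(H - (μ + r)) ∘ X = X ∘ (H - μ)` when `H X - X H = r X`, and the same for all powers. [folklore] -/
theorem pow_sub_comp_eq_of_commutator {H X : Module.End ℂ U} {r : ℂ} (hHX : H * X - X * H = r • X) (μ : ℂ)
    (k : ℕ) : (H - (μ + r) • (1 : Module.End ℂ U)) ^ k * X = X * (H - μ • (1 : Module.End ℂ U)) ^ k := by
  have h1 : (H - (μ + r) • (1 : Module.End ℂ U)) * X = X * (H - μ • (1 : Module.End ℂ U)) := by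
    have : H * X = X * H + r • X := by rw [← hHX]; abel
    calc (H - (μ + r) • (1 : Module.End ℂ U)) * X = H * X - (μ + r) • X := by
          rw [sub_mul, smul_mul_assoc, one_mul]
      _ = X * H + r • X - (μ + r) • X := by rw [this]
      _ = X * H - μ • X := by rw [add_smul]; abel
      _ = X * (H - μ • (1 : Module.End ℂ U)) := by rw [mul_sub, mul_smul_comm, mul_one]
  induction k with
  | zero => rw [pow_zero, pow_zero, one_mul, mul_one]
  | succ k ih => rw [pow_succ, mul_assoc, h1, ← mul_assoc, ih, mul_assoc, ← pow_succ]

/-- **An operator shifted by a skew one vanishes.**  On a finite-dimensional complex space with a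
positive definite Hermitian form, if `H` is skew and `H X - X H = r X` with `r ∈ ℝ ∖ 0`, then `X = 0`:
the eigenvalues of `H` are imaginary, `X` maps the generalised `μ`-eigenspace of `H` into the
generalised `(μ + r)`-eigenspace, which is zero since `μ + r` is not imaginary, and the generalised
eigenspaces span. [folklore] -/
theorem eq_zero_of_skew_of_commutator_eq_smul [FiniteDimensional ℂ U] {ip : U → U → ℂ} (hip : IsPosForm ip)
    {H X : Module.End ℂ U} (hH : ∀ u v, ip (H u) v = -ip u (H v)) {r : ℝ} (hr : r ≠ 0)
    (hHX : H * X - X * H = (r : ℂ) • X) : X = 0 := by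
  -- the real parts of the eigenvalues of `H` vanish
  have hre : ∀ μ : ℂ, H.maxGenEigenspace μ ≠ ⊥ → μ.re = 0 := by
    intro μ hμ
    rw [Module.End.maxGenEigenspace_eq_genEigenspace_finrank] at hμ
    have hev : H.HasEigenvalue μ :=
      Module.End.hasEigenvalue_of_hasGenEigenvalue (Module.End.hasGenEigenvalue_iff.mpr hμ)
    have h := conj_eq_neg_of_hasEigenvalue_of_skew hip hH hev
    have h' := congrArg Complex.re h
    rw [Complex.conj_re, Complex.neg_re] at h'
    linarith
  -- `X` kills every generalised eigenspace of `H`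
  have hker : ∀ μ : ℂ, H.maxGenEigenspace μ ≤ LinearMap.ker X := by
    intro μ v hv
    rw [LinearMap.mem_ker]
    obtain ⟨k, hk⟩ := (Module.End.mem_maxGenEigenspace H μ v).mp hv
    have hXv : X v ∈ H.maxGenEigenspace (μ + r) := by
      rw [Module.End.mem_maxGenEigenspace]
      refine ⟨k, ?_⟩
      have h := congrArg (fun T : Module.End ℂ U => T v) (pow_sub_comp_eq_of_commutator hHX μ k)
      simp only [Module.End.mul_apply] at h
      rw [h, hk, map_zero]
    by_contra hX0
    have hne : H.maxGenEigenspace (μ + r) ≠ ⊥ := by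
      intro hbot
      rw [hbot, Submodule.mem_bot] at hXv
      exact hX0 hXv
    have h1 := hre (μ + r) hne
    by_cases hμ : H.maxGenEigenspace μ = ⊥
    · rw [hμ, Submodule.mem_bot] at hv
      exact hX0 (by rw [hv, map_zero])
    · have h2 := hre μ hμ
      rw [Complex.add_re, h2, Complex.ofReal_re, zero_add] at h1
      exact hr h1
  have htop : (⊤ : Submodule ℂ U) ≤ LinearMap.ker X := by
    rw [← Module.End.iSup_maxGenEigenspace_eq_top H]
    exact iSup_le hker
  ext v
  have hv := htop (Submodule.mem_top (x := v))
  rwa [LinearMap.mem_ker] at hv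

/-- **A Lie action of `𝔤𝔩_n(𝕜)` (`𝕜 = ℝ` or `ℂ`) on a finite-dimensional complex space for which the
diagonal trace-zero matrices `E_ii - E_jj` act skew-adjointly for a positive definite Hermitian form
kills every trace-zero matrix**: `[E_ii - E_jj, c E_ij] = 2 c E_ij` forces `ρ(c E_ij) = 0` for
`i ≠ j` (`eq_zero_of_skew_of_commutator_eq_smul`), hence `ρ(c (E_ii - E_00)) = ρ [c E_i0, E_0i] = 0`,
and these span the trace-zero matrices over `ℝ`.  (Finite-dimensional unitary representations of
`𝔰𝔩_n` are trivial.) [folklore] -/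
theorem lieHom_apply_eq_zero_of_trace_eq_zero {𝕜 : Type*} [RCLike 𝕜] {n : ℕ} [FiniteDimensional ℂ U]
    {ip : U → U → ℂ} (hip : IsPosForm ip) (ρ : Matrix (Fin n) (Fin n) 𝕜 →ₗ⁅ℝ⁆ Module.End ℂ U)
    (hskew : ∀ (i j : Fin n) (u v : U),
      ip (ρ (Matrix.single i i 1 - Matrix.single j j 1) u) v =
        -ip u (ρ (Matrix.single i i 1 - Matrix.single j j 1) v))
    (Z : Matrix (Fin n) (Fin n) 𝕜) (hZ : Z.trace = 0) : ρ Z = 0 := by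
  -- off-diagonal elementary matrices act by zero
  have hoff : ∀ (i j : Fin n), i ≠ j → ∀ c : 𝕜, ρ (Matrix.single i j c) = 0 := by
    intro i j hij c
    have hbr : ⁅Matrix.single i i (1 : 𝕜) - Matrix.single j j 1, Matrix.single i j c⁆ =
        (2 : ℝ) • Matrix.single i j c := by
      rw [Ring.lie_def, sub_mul, mul_sub, Matrix.single_mul_single_same,
        Matrix.single_mul_single_of_ne (1 : 𝕜) j j i (Ne.symm hij) c, Matrix.single_mul_single_of_ne c i j i (Ne.symm hij) (1 : 𝕜),
        Matrix.single_mul_single_same, one_mul, mul_one, sub_zero, zero_sub, sub_neg_eq_add, two_smul]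
    have h := LieHom.map_lie ρ (Matrix.single i i (1 : 𝕜) - Matrix.single j j 1) (Matrix.single i j c)
    rw [hbr, map_smul, Ring.lie_def] at h
    refine eq_zero_of_skew_of_commutator_eq_smul hip (hskew i j) (r := 2) two_ne_zero ?_
    rw [← h]
    ext u
    change (2 : ℝ) • (ρ (Matrix.single i j c) u) = ((2 : ℝ) : ℂ) • (ρ (Matrix.single i j c) u)
    rw [Complex.coe_smul]
  -- diagonal differences act by zero
  have hdiag : ∀ (i j : Fin n) (c : 𝕜), ρ (Matrix.single i i c - Matrix.single j j c) = 0 := by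
    intro i j c
    by_cases hij : i = j
    · subst hij; rw [sub_self, map_zero]
    · have hbr : ⁅Matrix.single i j c, Matrix.single j i (1 : 𝕜)⁆ = Matrix.single i i c - Matrix.single j j c := by
        rw [Ring.lie_def, Matrix.single_mul_single_same, Matrix.single_mul_single_same, mul_one, one_mul]
      rw [← hbr, LieHom.map_lie, hoff i j hij, zero_lie]
  -- decomposition of a trace-zero matrix
  rcases Nat.eq_zero_or_pos n with hn | hn
  · subst hn
    rw [Subsingleton.elim Z 0, map_zero]
  · haveI : NeZero n := ⟨hn.ne'⟩
    -- `ρ Z = ∑_{i,j} ρ(Z_ij E_ij) = ∑_i ρ(Z_ii E_ii) = ∑_i ρ(Z_ii E_00) = ρ((tr Z) E_00) = 0`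
    have h1 : ρ Z = ∑ i : Fin n, ∑ j : Fin n, ρ (Matrix.single i j (Z i j)) := by
      conv_lhs => rw [Matrix.matrix_eq_sum_single Z]
      rw [map_sum]
      exact Finset.sum_congr rfl fun i _ => map_sum ρ _ _
    have h2 : ∀ i : Fin n, ∑ j : Fin n, ρ (Matrix.single i j (Z i j)) = ρ (Matrix.single i i (Z i i)) := fun i =>
      Finset.sum_eq_single i (fun j _ hji => hoff i j (Ne.symm hji) _) fun h => absurd (Finset.mem_univ i) h
    have h3 : ∀ i : Fin n, ρ (Matrix.single i i (Z i i)) = ρ (Matrix.single 0 0 (Z i i)) := fun i => by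
      have h := hdiag i 0 (Z i i)
      rwa [map_sub, sub_eq_zero] at h
    have h4 : ∑ i : Fin n, Matrix.single (0 : Fin n) (0 : Fin n) (Z i i) = Matrix.single 0 0 Z.trace :=
      (map_sum (Matrix.singleAddMonoidHom (0 : Fin n) (0 : Fin n)) (fun i => Z i i) Finset.univ).symm
    rw [h1]
    simp only [h2, h3]
    rw [← map_sum, h4, hZ, Matrix.single_zero, map_zero]

/-- A positive definite Hermitian form pulls back to one along an injective linear map. [folklore] -/
theorem IsPosForm.comap {ip : U → U → ℂ} (hip : IsPosForm ip) {V : Type*} [AddCommGroup V] [Module ℂ V]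
    (f : V →ₗ[ℂ] U) (hf : Function.Injective f) : IsPosForm (fun u v : V => ip (f u) (f v)) where
  add_left x y z := by simp only [map_add]; exact hip.add_left _ _ _
  smul_left c x y := by simp only [map_smul]; exact hip.smul_left _ _ _
  conj_symm x y := hip.conj_symm _ _
  nonneg x := hip.nonneg _
  definite x hx := hf ((hip.definite _ hx).trans (map_zero f).symm)

end Kuga

/-! ### Contraction of `V ⊗ E` against functionals on `E` -/

namespace TensorContract

variable {V E : Type*} [AddCommGroup V] [Module ℂ V] [AddCommGroup E] [Module ℂ E]

/-- The contraction `V ⊗ E → Hom(E^*, V)`, `v ⊗ e ↦ (f ↦ f(e) v)`. [folklore] -/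
def contract : V ⊗[ℂ] E →ₗ[ℂ] (Module.Dual ℂ E →ₗ[ℂ] V) :=
  TensorProduct.lift (LinearMap.mk₂ ℂ (fun (v : V) (e : E) => (Module.Dual.eval ℂ E e).smulRight v)
    (fun v v' e => by ext f; simp [smul_add])
    (fun a v e => by ext f; simp [smul_smul, mul_comm])
    (fun v e e' => by ext f; simp [add_smul])
    (fun a v e => by ext f; simp [smul_smul]))

/-- On pure tensors. [folklore] -/
@[simp] theorem contract_tmul (v : V) (e : E) (f : Module.Dual ℂ E) : contract (v ⊗ₜ[ℂ] e) f = f e • v := by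
  simp [contract]

/-- Naturality in `V`: `contract ((g ⊗ 1) c) f = g (contract c f)`. [folklore] -/
theorem contract_rTensor (g : V →ₗ[ℂ] V) (c : V ⊗[ℂ] E) (f : Module.Dual ℂ E) :
    contract (g.rTensor E c) f = g (contract c f) := by
  induction c using TensorProduct.induction_on with
  | zero => simp
  | tmul v e => simp
  | add x y hx hy => simp only [map_add, LinearMap.add_apply, hx, hy]

/-- Naturality in `E`: `contract ((1 ⊗ h) c) f = contract c (f ∘ h)`. [folklore] -/
theorem contract_lTensor (h : E →ₗ[ℂ] E) (c : V ⊗[ℂ] E) (f : Module.Dual ℂ E) :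
    contract (h.lTensor V c) f = contract c (f ∘ₗ h) := by
  induction c using TensorProduct.induction_on with
  | zero => simp
  | tmul v e => simp
  | add x y hx hy => simp only [map_add, LinearMap.add_apply, hx, hy]

/-- Expansion along a basis of `E`: `c = ∑ᵢ contract c (b^i) ⊗ bᵢ`. [folklore] -/
theorem eq_sum_contract_tmul {ι : Type*} [Fintype ι] (b : Module.Basis ι ℂ E) (c : V ⊗[ℂ] E) :
    c = ∑ i, contract c (b.coord i) ⊗ₜ[ℂ] b i := by
  induction c using TensorProduct.induction_on with
  | zero => simp
  | tmul v e =>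
    simp only [contract_tmul, Module.Basis.coord_apply]
    conv_lhs => rw [← b.sum_repr e]
    rw [TensorProduct.tmul_sum]
    refine Finset.sum_congr rfl fun i _ => ?_
    rw [TensorProduct.tmul_smul, TensorProduct.smul_tmul']
  | add x y hx hy =>
    conv_lhs => rw [hx, hy]
    rw [← Finset.sum_add_distrib]
    refine Finset.sum_congr rfl fun i _ => ?_
    rw [map_add, LinearMap.add_apply, TensorProduct.add_tmul]

/-- If all contractions of `c` vanish then `c = 0` (`E` finite-dimensional). [folklore] -/
theorem eq_zero_of_forall_contract_eq_zero [FiniteDimensional ℂ E] (c : V ⊗[ℂ] E)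
    (h : ∀ f : Module.Dual ℂ E, contract c f = 0) : c = 0 := by
  rw [eq_sum_contract_tmul (Module.finBasis ℂ E) c]
  exact Finset.sum_eq_zero fun i _ => by rw [h, TensorProduct.zero_tmul]

end TensorContract

/-! ### Cusp forms carry no finite-dimensional `𝔤`-stable subspace -/

namespace ConeDictionary

open ResGLnCohomology RealMatrixGroup Literature.Algebra.Lie.ChevalleyEilenberg

variable {n : ℕ} {K : Type} [Field K] [NumberField K] {hcpt : isCompact_glFiniteIntegralLevel n K}

/-- The norm exponent of `E_ii - E_jj` at a real place vanishes. [folklore] -/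
private theorem normExponent_realPlaceLie_single_sub (w : {w : InfinitePlace K // w.IsReal}) (i j : Fin n) :
    ((∑ w', (realPlaceLie n w (Matrix.single i i (1 : ℝ) - Matrix.single j j 1)).trace.1 w') +
      ∑ w', 2 * ((realPlaceLie n w (Matrix.single i i (1 : ℝ) - Matrix.single j j 1)).trace.2 w').re) = 0 := by
  rw [normExponent_realPlaceLie, Matrix.trace_sub, Matrix.trace_single_eq_same, Matrix.trace_single_eq_same,
    sub_self]

/-- The norm exponent of `E_ii - E_jj` at a complex place vanishes. [folklore] -/
private theorem normExponent_complexPlaceLie_single_sub (w : {w : InfinitePlace K // w.IsComplex}) (i j : Fin n) :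
    ((∑ w', (complexPlaceLie n w (Matrix.single i i (1 : ℂ) - Matrix.single j j 1)).trace.1 w') +
      ∑ w', 2 * ((complexPlaceLie n w (Matrix.single i i (1 : ℂ) - Matrix.single j j 1)).trace.2 w').re) = 0 := by
  rw [normExponent_complexPlaceLie, Matrix.trace_sub, Matrix.trace_single_eq_same, Matrix.trace_single_eq_same,
    sub_self, Complex.zero_re, mul_zero]

omit [NumberField K] in
/-- A square-zero real matrix has trace zero. [folklore] -/
private theorem trace_eq_zero_of_mul_self_eq_zero_real {Z : Matrix (Fin n) (Fin n) ℝ} (hZ : Z * Z = 0) :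
    Z.trace = 0 :=
  (Matrix.isNilpotent_trace_of_isNilpotent ⟨2, by rw [pow_two, hZ]⟩).eq_zero

set_option maxHeartbeats 800000 in
-- the towers over the datum are deep (as in the sibling `Apex` files)
/-- **Cusp forms on `GL_n`, `n ≥ 2`, contain no non-zero finite-dimensional `𝔤`-stable subspace.**
For a clean cuspidal `π` (`W ≤ 𝒜₀`, `W' = ⊥`), a `𝔤`-module `(V, ρ𝔤)` with an INJECTIVE intertwiner
`j : V → W`, and a finite-dimensional subspace `U ≤ V` stable under `ρ𝔤`, `U = 0`: along the pull-back
of the unitarily normalised Petersson form the trace-zero `X ∈ 𝔤` act skew-adjointly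
(`CuspidalPeterssonForm.pet_lieDerivW_left`), so at any infinite place `w` the action of `𝔤𝔩_n(K_w)`
on `U` kills `𝔰𝔩_n(K_w)` (`Kuga.lieHom_apply_eq_zero_of_trace_eq_zero`: a finite-dimensional unitary
representation of `𝔰𝔩_n` is trivial), and a cusp form killed by the square-zero directions at one
place vanishes (`eq_zero_of_mem_cuspFormsGL_of_forall_lieDeriv_eq_zero`).  This is the statement
"cuspidal `(𝔤, K_∞)`-modules of `GL_n`, `n ≥ 2`, have no finite-dimensional constituent", i.e.
`H⁰(𝔤, K_∞; V ⊗ E) = 0`. [cite: Harder1987, §3.1] [cite: BorelWallach2000, I 5.3] -/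
theorem eq_bot_of_finiteDimensional_of_lie_stable (hn : 2 ≤ n) (π : CuspidalAutomorphicRepData n K hcpt)
    (hW' : π.1.W' = ⊥) {V : Type*} [AddCommGroup V] [Module ℂ V]
    (ρ𝔤 : (AutomorphyDatum.gl n K hcpt).arch.lie →ₗ⁅ℝ⁆ Module.End ℂ V) (j : V →ₗ[ℂ] π.1.W)
    (hj𝔤 : ∀ X : (AutomorphyDatum.gl n K hcpt).arch.lie, j ∘ₗ ρ𝔤 X = π.1.lieRepW X ∘ₗ j)
    (hj : Function.Injective j) (U : Submodule ℂ V) [FiniteDimensional ℂ U]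
    (hU : ∀ X : (AutomorphyDatum.gl n K hcpt).arch.lie, U ≤ U.comap (ρ𝔤 X)) : U = ⊥ := by
  haveI : NeZero n := ⟨by omega⟩
  obtain ⟨μ, hμ⟩ := AdelicGroupData.exists_isAutomorphicMeasure_gl_holds n K
  obtain ⟨T⟩ := π.1.nonempty_unitaryTwist π.2 hW'
  have hipU : Kuga.IsPosForm (fun u v : U => T.pet μ (j (u : V)) (j (v : V))) :=
    (T.isPosForm_pet μ).comap (j ∘ₗ U.subtype) (hj.comp Subtype.val_injective)
  have hjX : ∀ (X : (AutomorphyDatum.gl n K hcpt).arch.lie) (v : V), j (ρ𝔤 X v) = π.1.lieRepW X (j v) :=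
    fun X v => LinearMap.congr_fun (hj𝔤 X) v
  -- the restricted Lie action on `U`, read on all of `M_n(K_∞)`
  let ρ' : Matrix (Fin n) (Fin n) (mixedSpace K) →ₗ⁅ℝ⁆ Module.End ℂ U :=
    (GKSubmodule.subLie (AutomorphyDatum.gl n K hcpt).arch ρ𝔤 U hU).comp
      (LieSubalgebra.topEquiv : (⊤ : LieSubalgebra ℝ (Matrix (Fin n) (Fin n) (mixedSpace K))) ≃ₗ⁅ℝ⁆
        Matrix (Fin n) (Fin n) (mixedSpace K)).symm.toLieHom
  have hρ' : ∀ (M : Matrix (Fin n) (Fin n) (mixedSpace K)) (x : U),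
      ((ρ' M x : U) : V) = ρ𝔤 (ResGLnCartan.ofMatrix M) (x : V) := fun _ _ => rfl
  -- the image of `u ∈ U` is a cusp form; it is killed by `X` as soon as `ρ' X` kills `u`
  rw [Submodule.eq_bot_iff]
  intro u hu
  suffices h0 : ((j u : π.1.W) : (AdelicGroupData.gl n K).Adelic → ℂ) = 0 by
    exact hj ((Subtype.ext h0 : j u = 0).trans (map_zero j).symm)
  have hju : ∀ M : Matrix (Fin n) (Fin n) (mixedSpace K), ρ' M = 0 →
      lieDeriv (AutomorphyDatum.gl n K hcpt).ofArch (ResGLnCartan.ofMatrix M)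
        ((j u : π.1.W) : (AdelicGroupData.gl n K).Adelic → ℂ) = 0 := by
    intro M hM
    have h := LinearMap.congr_fun hM ⟨u, hu⟩
    rw [LinearMap.zero_apply] at h
    have h' := congrArg (fun x : U => ((j (x : V) : π.1.W) : (AdelicGroupData.gl n K).Adelic → ℂ)) h
    simp only [hρ', hjX, Submodule.coe_zero, map_zero, AutomorphicRepData.lieRepW_apply] at h'
    exact h'
  -- `𝔰𝔩_n` at any infinite place acts by zero on `U`
  obtain ⟨w⟩ : Nonempty (InfinitePlace K) := inferInstance
  rcases w.isReal_or_isComplex with hw | hw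
  · -- a real place
    have hkill : ∀ Z : Matrix (Fin n) (Fin n) ℝ, Z.trace = 0 → ρ'.comp (realPlaceLie n ⟨w, hw⟩) Z = 0 :=
      Kuga.lieHom_apply_eq_zero_of_trace_eq_zero hipU (ρ'.comp (realPlaceLie n ⟨w, hw⟩)) fun i j' u' v => by
        have hX := normExponent_realPlaceLie_single_sub (K := K) ⟨w, hw⟩ i j'
        have key := T.pet_lieDerivW_left μ
          (ResGLnCartan.ofMatrix (realPlaceLie n ⟨w, hw⟩ (Matrix.single i i 1 - Matrix.single j' j' 1))) hX
          (j (u' : V)) (j (v : V))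
        rw [← AutomorphicRepData.lieRepW_apply, ← AutomorphicRepData.lieRepW_apply, ← hjX, ← hjX] at key
        rw [LieHom.comp_apply, hρ', hρ']
        exact key
    exact eq_zero_of_mem_cuspFormsGL_of_forall_lieDeriv_realPlace hn ⟨w, hw⟩ (π.le_cuspFormsGL (j u).2)
      fun Z hZ => hju _ (hkill Z (trace_eq_zero_of_mul_self_eq_zero_real hZ))
  · -- a complex place
    have hkill : ∀ Z : Matrix (Fin n) (Fin n) ℂ, Z.trace = 0 → ρ'.comp (complexPlaceLie n ⟨w, hw⟩) Z = 0 :=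
      Kuga.lieHom_apply_eq_zero_of_trace_eq_zero hipU (ρ'.comp (complexPlaceLie n ⟨w, hw⟩)) fun i j' u' v => by
        have hX := normExponent_complexPlaceLie_single_sub (K := K) ⟨w, hw⟩ i j'
        have key := T.pet_lieDerivW_left μ
          (ResGLnCartan.ofMatrix (complexPlaceLie n ⟨w, hw⟩ (Matrix.single i i 1 - Matrix.single j' j' 1))) hX
          (j (u' : V)) (j (v : V))
        rw [← AutomorphicRepData.lieRepW_apply, ← AutomorphicRepData.lieRepW_apply, ← hjX, ← hjX] at key
        rw [LieHom.comp_apply, hρ', hρ']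
        exact key
    exact π.eq_zero_of_forall_lieDeriv_complexPlace_trace hn ⟨w, hw⟩ (j u).2 fun Z hZ => hju _ (hkill Z hZ)

set_option maxHeartbeats 800000 in
-- as above
/-- **`H⁰(𝔤; V ⊗ E_λ) = 0` for a `𝔤`-module embedded in the cusp forms** (`n ≥ 2`): a `𝔤`-invariant
element `c` of `V ⊗ E_λ(ℂ)` — `(ρ𝔤 X ⊗ 1 + 1 ⊗ dE_λ X) c = 0` for all `X` — vanishes when `V` embeds
`𝔤`-equivariantly into the forms `W` of a clean cuspidal `π`: the contractions `⟨c, f⟩ ∈ V`,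
`f ∈ E_λ^*`, span a finite-dimensional `𝔤`-stable subspace (`X ⟨c, f⟩ = -⟨c, f ∘ dE_λ X⟩`), which is
zero by `eq_bot_of_finiteDimensional_of_lie_stable`, and `c = ∑ᵢ ⟨c, bⁱ⟩ ⊗ bᵢ`.
[cite: Harder1987, §3.1] [cite: BorelWallach2000, I 5.3] -/
theorem eq_zero_of_lie_invariant (hn : 2 ≤ n) (π : CuspidalAutomorphicRepData n K hcpt)
    (hW' : π.1.W' = ⊥) {V : Type*} [AddCommGroup V] [Module ℂ V]
    (ρ𝔤 : (AutomorphyDatum.gl n K hcpt).arch.lie →ₗ⁅ℝ⁆ Module.End ℂ V) (j : V →ₗ[ℂ] π.1.W)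
    (hj𝔤 : ∀ X : (AutomorphyDatum.gl n K hcpt).arch.lie, j ∘ₗ ρ𝔤 X = π.1.lieRepW X ∘ₗ j)
    (hj : Function.Injective j) (lam : (K →+* ℂ) → Fin n → ℤ)
    {c : V ⊗[ℂ] ResGLnCohomology.CoeffModule ℂ n K lam}
    (hc : ∀ X : (AutomorphyDatum.gl n K hcpt).arch.lie,
      GKTensor.lie (AutomorphyDatum.gl n K hcpt).arch ρ𝔤 (σ𝔤S hcpt lam) X c = 0) :
    c = 0 := by
  haveI : FiniteDimensional ℂ (ResGLnCohomology.CoeffModule ℂ n K lam) :=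
    ResGLnCohomology.finiteDimensional_coeffModule n K lam
  -- the span of the contractions of `c`
  let U : Submodule ℂ V := LinearMap.range (TensorContract.contract c)
  haveI : FiniteDimensional ℂ U := LinearMap.finiteDimensional_range _
  have hU : ∀ X : (AutomorphyDatum.gl n K hcpt).arch.lie, U ≤ U.comap (ρ𝔤 X) := by
    rintro X _ ⟨f, rfl⟩
    have h := hc X
    rw [GKTensor.lie_apply, LinearMap.add_apply, add_eq_zero_iff_eq_neg] at h
    rw [Submodule.mem_comap, ← TensorContract.contract_rTensor, h, map_neg, LinearMap.neg_apply,
      TensorContract.contract_lTensor]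
    exact U.neg_mem ⟨_, rfl⟩
  have hbot : U = ⊥ := eq_bot_of_finiteDimensional_of_lie_stable hn π hW' ρ𝔤 j hj𝔤 hj U hU
  refine TensorContract.eq_zero_of_forall_contract_eq_zero c fun f => ?_
  have hf : TensorContract.contract c f ∈ U := ⟨f, rfl⟩
  rw [hbot, Submodule.mem_bot] at hf
  exact hf

/-! ### From a non-zero `(𝔤, K_∞)`-cohomology class to a non-zero basic cochain of positive degree -/

section Basic

variable {V : Type} [AddCommGroup V] [Module ℂ V]
  {ρK : Representation ℂ (AutomorphyDatum.gl n K hcpt).arch.maximalCompact V}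
  {ρ𝔤 : (AutomorphyDatum.gl n K hcpt).arch.lie →ₗ⁅ℝ⁆ Module.End ℂ V}
  (had : ∀ (k : (AutomorphyDatum.gl n K hcpt).arch.maximalCompact) (X : (AutomorphyDatum.gl n K hcpt).arch.lie),
    ρK k ∘ₗ ρ𝔤 X ∘ₗ ρK k⁻¹ =
      ρ𝔤 ((AutomorphyDatum.gl n K hcpt).arch.Ad
        (Subgroup.inclusion (AutomorphyDatum.gl n K hcpt).arch.maximalCompact_le_carrier k) X))
  (S : Finset {w : InfinitePlace K // w.IsReal}) (lam : (K →+* ℂ) → Fin n → ℤ)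

/-- `Z` acts on `V ⊗ E_λ` by the scalar `a + |λ|` when it acts on `V` by `a`. [cite: BorelWallach2000, I §1.3] -/
theorem lie_centerOne_carrierV {a : ℂ} (ha : ∀ v : V, ρ𝔤 (centerOne n K hcpt) v = a • v) (t : CarrierV ρ𝔤 lam) :
    ⁅centerOne n K hcpt, t⁆ = (a + coeffCentralWeight n K lam) • t := by
  have hV : ρ𝔤 (centerOne n K hcpt) = a • LinearMap.id := LinearMap.ext ha
  have hE : σ𝔤S hcpt lam (centerOne n K hcpt) = coeffCentralWeight n K lam • LinearMap.id :=
    LinearMap.ext (archCoeffLie_centerOne lam)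
  have key : GKTensor.lie (AutomorphyDatum.gl n K hcpt).arch ρ𝔤 (σ𝔤S hcpt lam) (centerOne n K hcpt) =
      (a + coeffCentralWeight n K lam) • LinearMap.id := by
    rw [GKTensor.lie_apply, hV, hE, LinearMap.rTensor_smul, LinearMap.lTensor_smul, LinearMap.rTensor_id,
      LinearMap.lTensor_id, add_smul]
  exact LinearMap.congr_fun key t

set_option maxHeartbeats 800000 in
-- as above
/-- **A non-zero `(𝔤, K_∞)`-cohomology class of a module embedded in the cusp forms yields a non-zero
BASIC cochain of positive degree** (`n ≥ 2`).  Let `(V, ρK, ρ𝔤)` carry an injective `𝔤`-intertwiner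
`j : V → W` into the forms of a clean cuspidal `π`, let `Z = 1` act on `V` by a scalar, and let
`H^q(𝔤, K_∞; V ⊗ (E_λ ⊗ ε_S)) ≠ 0`.  Then some `C^{q'+1}(𝔤, K_∞; V ⊗ (E_λ ⊗ ε_S))` contains a non-zero
cochain `z` with `i_Z z = 0`: a cocycle `η` which is not a coboundary has degree `q ≥ 1`
(`eq_zero_of_lie_invariant`: `H⁰ = 0`); either `i_Z η = 0` (take `z = η`), or `i_Z η ≠ 0` is basic of
degree `q - 1`, and `q - 1 ≥ 1` unless `q = 1`, where Cartan's formula `θ_Z η = d(i_Z η)` with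
`θ_Z = c` makes `η = d(c⁻¹ i_Z η)` a coboundary (`c ≠ 0`) or `i_Z η` a non-zero invariant (`c = 0`),
both absurd. [cite: BorelWallach2000, I §1.3, I 5.3] [cite: Clozel1990, Lemme 3.14 (p. 114)] -/
theorem exists_nonzero_basic_of_nontrivial_cohomology (hn : 2 ≤ n) (π : CuspidalAutomorphicRepData n K hcpt)
    (hW' : π.1.W' = ⊥) {j : V →ₗ[ℂ] π.1.W}
    (hj𝔤 : ∀ X : (AutomorphyDatum.gl n K hcpt).arch.lie, j ∘ₗ ρ𝔤 X = π.1.lieRepW X ∘ₗ j)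
    (hj : Function.Injective j) {a : ℂ} (ha : ∀ v : V, ρ𝔤 (centerOne n K hcpt) v = a • v) {q : ℕ}
    (hH : Nontrivial ((gkComplexV ρK ρ𝔤 had S lam).Cohomology q)) :
    ∃ (q' : ℕ) (z : Literature.Algebra.Lie.ChevalleyEilenberg.Cochain ℝ (AutomorphyDatum.gl n K hcpt).arch.lie
        (CarrierV ρ𝔤 lam) (q' + 1)),
      z ∈ (gkComplexV ρK ρ𝔤 had S lam).carrier (q' + 1) ∧ ins q' (centerOne n K hcpt) z = 0 ∧ z ≠ 0 := by
  have hz : ∀ X : (AutomorphyDatum.gl n K hcpt).arch.lie, ⁅centerOne n K hcpt, X⁆ = 0 := centerOne_lie n K hcpt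
  have hzP : ∀ k : (AutomorphyDatum.gl n K hcpt).arch.maximalCompact,
      (pairActionV ρK ρ𝔤 had S lam).σ k (centerOne n K hcpt) = centerOne n K hcpt := fun k => Ad_centerOne n K hcpt _
  have hc := lie_centerOne_carrierV lam ha
  -- a `0`-cocycle vanishes (`H⁰ = 0`)
  have h0 : ∀ f : Literature.Algebra.Lie.ChevalleyEilenberg.Cochain ℝ (AutomorphyDatum.gl n K hcpt).arch.lie
      (CarrierV ρ𝔤 lam) 0,
      d ℝ (AutomorphyDatum.gl n K hcpt).arch.lie (CarrierV ρ𝔤 lam) 0 f = 0 → f = 0 := by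
    intro f hf
    rw [d_zero_eq_zero_iff] at hf
    have hval : f ![] = 0 :=
      eq_zero_of_lie_invariant hn π hW' ρ𝔤 j hj𝔤 hj lam (c := f ![]) fun X => hf X ![]
    ext v
    rw [show v = ![] from Subsingleton.elim v ![], hval, AlternatingMap.zero_apply]
  obtain ⟨x, hx⟩ := exists_ne (0 : (gkComplexV ρK ρ𝔤 had S lam).Cohomology q)
  obtain ⟨η, hη, hηB⟩ := (gkComplexV ρK ρ𝔤 had S lam).exists_not_mem_coboundaries_of_ne_zero q x hx
  obtain ⟨hηS, hdη⟩ := ((gkComplexV ρK ρ𝔤 had S lam).mem_cocycles_iff q η).1 hη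
  have hne : η ≠ 0 := fun h => hηB (h ▸ Submodule.zero_mem _)
  cases q with
  | zero => exact absurd (h0 η hdη) hne
  | succ q' =>
    by_cases hins : ins q' (centerOne n K hcpt) η = 0
    · exact ⟨q', η, hηS, hins, hne⟩
    · -- `i_Z η ≠ 0` is a basic cochain of the complex, of degree `q'`
      have hz'S : ins q' (centerOne n K hcpt) η ∈ (gkComplexV ρK ρ𝔤 had S lam).carrier q' :=
        ins_mem_gK_of_central _ (pairActionV ρK ρ𝔤 had S lam) hz hzP q' η hηS
      cases q' with
      | succ q'' => exact ⟨q'', _, hz'S, ins_self q'' _ η, hins⟩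
      | zero =>
        exfalso
        -- Cartan: `θ_Z η = i_Z dη + d (i_Z η) = d (i_Z η)` and `θ_Z η = (a + |λ|) η`
        have hθ := lieDer_eq_smul_of_central (R := ℝ) (centerOne n K hcpt) hz hc (0 + 1) η
        have hcart := lieDer_eq_ins_d_add_d_ins (R := ℝ) (M := CarrierV ρ𝔤 lam) 0 (centerOne n K hcpt) η
        rw [hdη, map_zero, hθ] at hcart
        simp only [zero_add] at hcart
        by_cases hcst : a + coeffCentralWeight n K lam = 0
        · rw [hcst, zero_smul] at hcart
          exact hins (h0 _ hcart.symm)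
        · refine hηB (((gkComplexV ρK ρ𝔤 had S lam).mem_coboundaries_succ_iff 0 η).2
            ⟨(a + coeffCentralWeight n K lam)⁻¹ • ins 0 (centerOne n K hcpt) η,
              Subcomplex.SMulStable.smul_mem _ _ _ hz'S, ?_⟩)
          rw [d_smul, ← hcart, smul_smul, inv_mul_cancel₀ hcst, one_smul]

end Basic

end ConeDictionary

end Literature.NumberTheory.Automorphic

end
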